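import Mathlib
import Summits.Ventures.HodgeRepro.Tier4.Common.ArchAssembleProd
import Summits.Ventures.HodgeRepro.Tier4.Line4.TransporterLocal
import Summits.Ventures.HodgeRepro.Tier4.Line4.CharacterPairSeesawCover

/-!
# Tier4/Line4/CharacterPairCons — the consistency clause `hcons` of the wall's PAIR REDUCED to the agreement of the
two archimedean weight characters on `T_∞ ∩ T′_∞` (C-L4-B-EXTEND, part 7 = V-B6 of the (B) row census)

Blind re-derivation cell `pub-hodge-repro`, Tier 4 «prove the step» (README §9–§10), seat t4-x2 (reserve
wall-breaker, gen 6; GO S16576).  Tree path `lean/Summits/Ventures/HodgeRepro/Tier4/Line4/CharacterPairCons.lean`.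
Imports: Mathlib + Common (`ArchAssembleProd`: `map_eq_prod_ofPlace_of_mem_infinitePart`; `ArchAssemble`: `ofPlace`
lemmas) + Line4 (`TransporterLocal` (L2-p3): `exists_heightOneSpectrum_natCast_mem`; `FinitePlacePositivity` (L2-p3):
`ofFinPart_mul`, `ofFinPart_mem_torusT`; `TorusProduct` (L2-p1): `ofFinPart_eq_one_of_mem_infinitePart`;
`ArchAssemble`: `infiniteComponent_ofPlace_self` (the slice lemma `weightAt_ofPlace_self_x2` is proved here); `CharacterPairSeesawCover` and through it the whole C-L4-B-EXTEND
chain).  No definition, no instance, no printed theorem proved.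

WHAT.  CharacterPairSeesaw(Cover)'s pair theorem displays ONE clause `hcons`: for `t ∈ T′_∞` and central `z` with
`t · z ∈ T′(k)`, `torusWeight' eP′ eM′ t · chi z = 1`.  Here it is REDUCED, for a `chi` with the wall's `_hchi`:
* `mem_torusT_of_mem_rationalPoints_of_ofFinPart_mem` (any plane) — a RATIONAL element of `G(𝔸)` whose finite part
  lies in `T` lies in `T`: its matrix is `adMat A` with `A` rational, the commutation `A · P i = P i · A` is read at
  one finite place (`k → k_v` injective; the p723452 pattern);
* `chi_eq_prod_weight_of_chiMatchesAt` — a multiplicative `chi` on `T(𝔸)` with `_hchi` at every infinite place takes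
  on `T_∞` the value of the `T`-weight character `∏_w weightAt … w 0 t ^ (−eP w) · weightAt … w 1 t ^ (−eM w)`
  (`T_∞ = ∏_w T_w`, `map_eq_prod_ofPlace_of_mem_infinitePart`);
* **`hcons_of_weights_agree`** — `hcons` follows from `hagree : ∀ t ∈ T_∞ ∩ T′_∞, ψ t = ψ′ t` (the two weight
  characters agree on the archimedean intersection of the tori): `t · z ∈ T′(k)` rational with finite part `z_f ∈ T_f`
  lies in `T(k)`, so `t ∈ T_∞ ∩ T′_∞`, `chi z = (chi t)⁻¹ = (ψ t)⁻¹ = (ψ′ t)⁻¹`;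
* **`exists_wall_character'_pair_seesaw_of_agree`** — the wall's `chi′` with `_hchi'` and `chi_centre` for a `chi`
  with `_hchi`, modulo the print `hDE'` and `hagree` ONLY (part 6's theorem with `hcons` discharged).
On `Z_∞` the clause `hagree` is `eP w + eM w = eP′ w + eM′ w` at every real place (a central element has the same
weight on both lines and both tori) — the dictionary's N2 relation; where `T_∞ ∩ T′_∞ ⊋ Z_∞` it asks more.  Nothing
here says anything about the status of the Hodge conjecture for CM abelian varieties, which is NOT proved; HC_CM is NOT
proved by anyone in this repository.
-/

set_option autoImplicit false

noncomputable section

namespace Summit.Ventures.HodgeRepro.Tier4.Line4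

open NumberField Matrix IsDedekindDomain Summit.Ventures.HodgeRepro.Tier4.Common
  Summit.Ventures.HodgeRepro.Tier4.Line1 Summit.Ventures.HodgeRepro.Tier4.Lit

section Rational

variable {k : Type} [Field k] [NumberField k] in
/-- the `w`-weights of the `w`-slice are the `w`-weights (the `w`-component of `ofPlace w g` is that of `g`). -/
theorem weightAt_ofPlace_self_x2 (W : PlaneData k) (q : QuadData k) (w : InfinitePlace k) (j : Fin 2) (g : GA W) :
    weightAt W q w j (ofPlace W w g) = weightAt W q w j g := by
  unfold weightAt entryAt
  rw [infiniteComponent_ofPlace_self]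


variable {k : Type} [Field k] [NumberField k] (W : PlaneData k)

/-- **A rational element whose finite part lies in `T` lies in `T`**: its matrix is `adMat A` with `A` rational; the
commutation with `P i` holds for the finite part, hence for `A · P i` and `P i · A` read at one finite place `v`, hence
over `k` (`k → k_v` injective), hence adelically. -/
theorem mem_torusT_of_mem_rationalPoints_of_ofFinPart_mem {g : GA W} (hr : g ∈ rationalPoints W)
    (hf : GA.ofFinPart W g ∈ torusT W) : g ∈ torusT W := by
  rw [rationalPoints, Subgroup.mem_subgroupOf, principalGL, MonoidHom.mem_range] at hr
  obtain ⟨A, hA⟩ := hr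
  have hmat : GA.mat W g = adMat k (A : Matrix (Fin 4) (Fin 4) k) := by
    have h1 : ((Matrix.GeneralLinearGroup.map (algebraMap k (Ad k)) A : GL4 k) : M4 k) = ((g : GL4 k) : M4 k) :=
      congrArg Units.val hA
    show ((g : GL4 k) : M4 k) = adMat k (A : Matrix (Fin 4) (Fin 4) k)
    rw [← h1]
    show (RingHom.mapMatrix (algebraMap k (Ad k))) (A : Matrix (Fin 4) (Fin 4) k) = adMat k (A : Matrix (Fin 4) (Fin 4) k)
    rw [RingHom.mapMatrix_apply]
    rfl
  obtain ⟨v, -⟩ := exists_heightOneSpectrum_natCast_mem k 2 Nat.prime_two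
  have hinj : Function.Injective (algebraMap k (v.adicCompletion k)) := (algebraMap k (v.adicCompletion k)).injective
  -- the finite-part commutation with a rational matrix `P` forces the rational commutation
  have key : ∀ P : Matrix (Fin 4) (Fin 4) k,
      GA.mat W (GA.ofFinPart W g) * adMat k P = adMat k P * GA.mat W (GA.ofFinPart W g) →
      (A : Matrix (Fin 4) (Fin 4) k) * P = P * (A : Matrix (Fin 4) (Fin 4) k) := by
    intro P h1
    have h2 := congrArg (finM k) h1
    rw [finM_mul, finM_mul, GA.mat_ofFinPart, finM_mixM, hmat, ← finM_mul, ← finM_mul, ← adMat_mul, ← adMat_mul] at h2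
    ext r c
    have h := congrFun (congrFun h2 r) c
    have h' := congrArg (fun x : FiniteAdeleRing (𝓞 k) k => x v) h
    simp only [finM, adMat, Matrix.map_apply] at h'
    have hl : ∀ x : k, finPart k (algebraMap k (Ad k) x) v = algebraMap k (v.adicCompletion k) x := fun x => rfl
    rw [hl, hl] at h'
    exact hinj h'
  have h0 : (A : Matrix (Fin 4) (Fin 4) k) * W.P 0 = W.P 0 * (A : Matrix (Fin 4) (Fin 4) k) := key _ hf.1
  have h1 : (A : Matrix (Fin 4) (Fin 4) k) * W.P 1 = W.P 1 * (A : Matrix (Fin 4) (Fin 4) k) := key _ hf.2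
  refine ⟨?_, ?_⟩
  · show GA.mat W g * adMat k (W.P 0) = adMat k (W.P 0) * GA.mat W g
    rw [hmat, ← adMat_mul, ← adMat_mul, h0]
  · show GA.mat W g * adMat k (W.P 1) = adMat k (W.P 1) * GA.mat W g
    rw [hmat, ← adMat_mul, ← adMat_mul, h1]

end Rational

section Cons

variable {k : Type} [Field k] [NumberField k] (q : QuadData k) (a : Fin 4 → k)
  (g g' : Matrix (Fin 4) (Fin 4) k) (hgg' : g * g' = 1) (hg'g : g' * g = 1)
  (hgΩ : g * (PlaneData.mixedRow q (a 0) (a 2)).Ω = (PlaneData.mixedRow q (a 0) (a 2)).Ω * g)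

/-- **A character with `_hchi` is the weight character on `T_∞`**: for `chi` multiplicative on `T(𝔸)` with
`ChiMatchesAt … (eP w) (eM w) chi` at every infinite place, and `t ∈ T_∞`,
`chi t = ∏_w weightAt … w 0 t ^ (−eP w) · weightAt … w 1 t ^ (−eM w)` (`T_∞ = ∏_w T_w`). -/
theorem chi_eq_prod_weight_of_chiMatchesAt
    (chi : torusT ((PlaneData.mixedRow q (a 0) (a 2)).withTransportedTorus g g' hgg' hg'g hgΩ) → ℂ)
    (hmul : ∀ s t, chi (s * t) = chi s * chi t) (hunit : ∀ t, ‖chi t‖ = 1) (eP eM : InfinitePlace k → ℤ)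
    (hchi : ∀ w, ChiMatchesAt ((PlaneData.mixedRow q (a 0) (a 2)).withTransportedTorus g g' hgg' hg'g hgΩ) q w (eP w)
      (eM w) chi)
    (t : torusT ((PlaneData.mixedRow q (a 0) (a 2)).withTransportedTorus g g' hgg' hg'g hgΩ))
    (htinf : t.1 ∈ infinitePart ((PlaneData.mixedRow q (a 0) (a 2)).withTransportedTorus g g' hgg' hg'g hgΩ)) :
    chi t = ∏ w : InfinitePlace k,
      (weightAt ((PlaneData.mixedRow q (a 0) (a 2)).withTransportedTorus g g' hgg' hg'g hgΩ) q w 0 t.1 ^ (-(eP w)) *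
        weightAt ((PlaneData.mixedRow q (a 0) (a 2)).withTransportedTorus g g' hgg' hg'g hgΩ) q w 1 t.1 ^ (-(eM w))) := by
  classical
  have hchi1 : chi 1 = 1 := by
    have h := hmul 1 1
    rw [one_mul] at h
    have h0 : chi 1 ≠ 0 := by
      intro h0
      have := hunit 1
      rw [h0, norm_zero] at this
      exact zero_ne_one this
    exact (mul_left_eq_self₀.1 h.symm).resolve_right h0
  -- `chi` as a function on `G(𝔸)`, multiplicative on `T`
  let f : GA ((PlaneData.mixedRow q (a 0) (a 2)).withTransportedTorus g g' hgg' hg'g hgΩ) → ℂ := fun x =>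
    if h : x ∈ torusT ((PlaneData.mixedRow q (a 0) (a 2)).withTransportedTorus g g' hgg' hg'g hgΩ) then chi ⟨x, h⟩ else 1
  have hf : ∀ x ∈ torusT ((PlaneData.mixedRow q (a 0) (a 2)).withTransportedTorus g g' hgg' hg'g hgΩ),
      ∀ y ∈ torusT ((PlaneData.mixedRow q (a 0) (a 2)).withTransportedTorus g g' hgg' hg'g hgΩ), f (x * y) = f x * f y := by
    intro x hx y hy
    simp only [f, dif_pos hx, dif_pos hy, dif_pos (Subgroup.mul_mem _ hx hy)]
    exact hmul ⟨x, hx⟩ ⟨y, hy⟩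
  have hf1 : f 1 = 1 := by
    simp only [f, dif_pos (Subgroup.one_mem _)]
    exact hchi1
  have hft : f t.1 = chi t := by simp only [f, dif_pos t.2]
  rw [← hft, map_eq_prod_ofPlace_of_mem_infinitePart _ (torusT _) f hf hf1 htinf
    (fun w => ofPlace_mem_torusT _ w t.2)]
  refine Finset.prod_congr rfl fun w _ => ?_
  have hmem : ofPlace ((PlaneData.mixedRow q (a 0) (a 2)).withTransportedTorus g g' hgg' hg'g hgΩ) w t.1 ∈
      torusT ((PlaneData.mixedRow q (a 0) (a 2)).withTransportedTorus g g' hgg' hg'g hgΩ) := ofPlace_mem_torusT _ w t.2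
  simp only [f, dif_pos hmem]
  have hloc := hchi w ⟨_, hmem⟩ (ofPlace_mem_localTorusAt _ w t.2)
  simp only at hloc
  rw [weightAt_ofPlace_self_x2, weightAt_ofPlace_self_x2] at hloc
  rw [_root_.zpow_neg, _root_.zpow_neg, ← mul_inv]
  exact eq_inv_of_mul_eq_one_left (by rw [← mul_assoc]; exact hloc)

include q a g g' hgg' hg'g hgΩ in
/-- the weight character does not vanish on `T(𝔸)` (each factor has modulus one). -/
theorem prod_weight_ne_zero_seesaw (ha0 : a 0 ≠ 0) (ha2 : a 2 ≠ 0) (hreal : ∀ w : InfinitePlace k, w.IsReal)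
    (hcm : ∀ w, IsCMAt q w) (eP eM : InfinitePlace k → ℤ)
    (t : torusT ((PlaneData.mixedRow q (a 0) (a 2)).withTransportedTorus g g' hgg' hg'g hgΩ)) :
    (∏ w : InfinitePlace k,
      (weightAt ((PlaneData.mixedRow q (a 0) (a 2)).withTransportedTorus g g' hgg' hg'g hgΩ) q w 0 t.1 ^ (-(eP w)) *
        weightAt ((PlaneData.mixedRow q (a 0) (a 2)).withTransportedTorus g g' hgg' hg'g hgΩ) q w 1 t.1 ^ (-(eM w)))) ≠ 0 :=
  Finset.prod_ne_zero_iff.mpr fun w _ => mul_ne_zero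
    (zpow_ne_zero _ (weightAt_ne_zero_seesaw q a g g' hgg' hg'g hgΩ ha0 ha2 w (hreal w) (hcm w) 0 t.2))
    (zpow_ne_zero _ (weightAt_ne_zero_seesaw q a g g' hgg' hg'g hgΩ ha0 ha2 w (hreal w) (hcm w) 1 t.2))

/-- **THE CONSISTENCY CLAUSE FROM THE AGREEMENT OF THE WEIGHT CHARACTERS ON `T_∞ ∩ T′_∞`**: for `chi` with the wall's
`chi_mul`, `chi_rational`, `hu`, `_hchi`, the clause `hcons` of `exists_wall_character'_pair_seesaw` follows from
`hagree : ∀ t ∈ T ∩ T′ ∩ G_∞, ψ t = ψ′ t`.  Proof: `t · z ∈ T′(k)` is rational with finite part `z_f ∈ T_f`, hence in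
`T(k)` (`mem_torusT_of_mem_rationalPoints_of_ofFinPart_mem`); so `t ∈ T_∞ ∩ T′_∞`, `chi z = (chi t)⁻¹`, `chi t = ψ t`
(`chi_eq_prod_weight_of_chiMatchesAt`) and `ψ t = ψ′ t`. -/
theorem hcons_of_weights_agree (ha0 : a 0 ≠ 0) (ha2 : a 2 ≠ 0)
    (hreal : ∀ w : InfinitePlace k, w.IsReal) (hcm : ∀ w, IsCMAt q w)
    (chi : torusT ((PlaneData.mixedRow q (a 0) (a 2)).withTransportedTorus g g' hgg' hg'g hgΩ) → ℂ)
    (hmul : ∀ s t, chi (s * t) = chi s * chi t)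
    (hrat : ∀ t ∈ rationalOf ((PlaneData.mixedRow q (a 0) (a 2)).withTransportedTorus g g' hgg' hg'g hgΩ)
      (torusT ((PlaneData.mixedRow q (a 0) (a 2)).withTransportedTorus g g' hgg' hg'g hgΩ)), chi t = 1)
    (hunit : ∀ t, ‖chi t‖ = 1) (eP eM eP' eM' : InfinitePlace k → ℤ)
    (hchi : ∀ w, ChiMatchesAt ((PlaneData.mixedRow q (a 0) (a 2)).withTransportedTorus g g' hgg' hg'g hgΩ) q w (eP w)
      (eM w) chi)
    (hagree : ∀ t : GA ((PlaneData.mixedRow q (a 0) (a 2)).withTransportedTorus g g' hgg' hg'g hgΩ),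
      t ∈ torusT ((PlaneData.mixedRow q (a 0) (a 2)).withTransportedTorus g g' hgg' hg'g hgΩ) →
      t ∈ torusT' ((PlaneData.mixedRow q (a 0) (a 2)).withTransportedTorus g g' hgg' hg'g hgΩ) →
      t ∈ infinitePart ((PlaneData.mixedRow q (a 0) (a 2)).withTransportedTorus g g' hgg' hg'g hgΩ) →
      (∏ w : InfinitePlace k,
        (weightAt ((PlaneData.mixedRow q (a 0) (a 2)).withTransportedTorus g g' hgg' hg'g hgΩ) q w 0 t ^ (-(eP w)) *
          weightAt ((PlaneData.mixedRow q (a 0) (a 2)).withTransportedTorus g g' hgg' hg'g hgΩ) q w 1 t ^ (-(eM w)))) =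
        torusWeight' q a g g' hgg' hg'g hgΩ eP' eM' t) :
    ∀ (t : torusT' ((PlaneData.mixedRow q (a 0) (a 2)).withTransportedTorus g g' hgg' hg'g hgΩ))
      (z : GA ((PlaneData.mixedRow q (a 0) (a 2)).withTransportedTorus g g' hgg' hg'g hgΩ))
      (hz : z ∈ centre ((PlaneData.mixedRow q (a 0) (a 2)).withTransportedTorus g g' hgg' hg'g hgΩ)),
      t.1 ∈ infinitePart ((PlaneData.mixedRow q (a 0) (a 2)).withTransportedTorus g g' hgg' hg'g hgΩ) →
      t.1 * z ∈ rationalPoints ((PlaneData.mixedRow q (a 0) (a 2)).withTransportedTorus g g' hgg' hg'g hgΩ) →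
      torusWeight' q a g g' hgg' hg'g hgΩ eP' eM' t.1 * chi ⟨z, centre_le_torusT _ hz⟩ = 1 := by
  intro t z hz htinf hγr
  have hzT : z ∈ torusT ((PlaneData.mixedRow q (a 0) (a 2)).withTransportedTorus g g' hgg' hg'g hgΩ) :=
    centre_le_torusT _ hz
  -- `t · z` is rational with finite part `z_f ∈ T_f`: it lies in `T`
  have hγT : t.1 * z ∈ torusT ((PlaneData.mixedRow q (a 0) (a 2)).withTransportedTorus g g' hgg' hg'g hgΩ) := by
    apply mem_torusT_of_mem_rationalPoints_of_ofFinPart_mem _ hγr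
    rw [ofFinPart_mul, ofFinPart_eq_one_of_mem_infinitePart _ htinf, one_mul]
    exact ofFinPart_mem_torusT _ hzT
  have htT : t.1 ∈ torusT ((PlaneData.mixedRow q (a 0) (a 2)).withTransportedTorus g g' hgg' hg'g hgΩ) := by
    have h : t.1 = (t.1 * z) * z⁻¹ := by rw [mul_inv_cancel_right]
    rw [h]
    exact Subgroup.mul_mem _ hγT (Subgroup.inv_mem _ hzT)
  -- `chi z = (chi t)⁻¹`
  have hchi1 : chi 1 = 1 := by
    have h := hmul 1 1
    rw [one_mul] at h
    have h0 : chi 1 ≠ 0 := by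
      intro h0
      have := hunit 1
      rw [h0, norm_zero] at this
      exact zero_ne_one this
    exact (mul_left_eq_self₀.1 h.symm).resolve_right h0
  have hγ1 : chi ⟨t.1 * z, hγT⟩ = 1 := by
    apply hrat
    rw [rationalOf, Subgroup.mem_subgroupOf]
    exact hγr
  have hzeq : (⟨z, hzT⟩ : torusT ((PlaneData.mixedRow q (a 0) (a 2)).withTransportedTorus g g' hgg' hg'g hgΩ)) =
      (⟨t.1, htT⟩ : torusT _)⁻¹ * ⟨t.1 * z, hγT⟩ := by
    apply Subtype.ext
    show z = t.1⁻¹ * (t.1 * z)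
    rw [inv_mul_cancel_left]
  have hinv : chi ((⟨t.1, htT⟩ : torusT _)⁻¹) * chi ⟨t.1, htT⟩ = 1 := by
    rw [← hmul, inv_mul_cancel, hchi1]
  have hzval : chi ⟨z, hzT⟩ = (chi ⟨t.1, htT⟩)⁻¹ := by
    rw [hzeq, hmul, hγ1, mul_one]
    exact eq_inv_of_mul_eq_one_left hinv
  -- `chi t = ψ t = ψ′ t`
  have hψ := chi_eq_prod_weight_of_chiMatchesAt q a g g' hgg' hg'g hgΩ chi hmul hunit eP eM hchi ⟨t.1, htT⟩ htinf
  have hne := prod_weight_ne_zero_seesaw q a g g' hgg' hg'g hgΩ ha0 ha2 hreal hcm eP eM ⟨t.1, htT⟩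
  show torusWeight' q a g g' hgg' hg'g hgΩ eP' eM' t.1 * chi ⟨z, hzT⟩ = 1
  rw [hzval, hψ, ← hagree t.1 htT t.2 htinf]
  exact mul_inv_cancel₀ hne

variable (lam : k) (hlam : lam ≠ 0)
  (hiso : g * (PlaneData.mixedRow q (a 1) (a 3)).B * gᵀ = lam • (PlaneData.mixedRow q (a 0) (a 2)).B)

include lam hlam hiso in
/-- **THE WALL'S `chi′` WITH `_hchi'` AND `chi_centre` ON THE SEESAW PLANE, modulo the print and `hagree` ONLY**: for
a `chi` with the wall's `chi_mul`, `chi_rational`, `hc`, `hu`, `_hchi` (e.g. part 3a's) and integers `eP′ eM′` whose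
weight character agrees with `chi`'s on `T_∞ ∩ T′_∞` (`hagree`), a `chi′` on `T′` with `chi'_mul`, `chi'_rational`,
`hc'`, `_hunit'`, `_hchi'` and `chi_centre` — `exists_wall_character'_pair_seesaw_of_aniso` with `hcons` discharged by
`hcons_of_weights_agree`. -/
theorem exists_wall_character'_pair_seesaw_of_agree (ht : q.t = 0) (hn : ¬ IsSquare (-q.n)) (ha : ∀ i, a i ≠ 0)
    (hreal : ∀ w : InfinitePlace k, w.IsReal) (hcm : ∀ w, IsCMAt q w)
    (hA : IsAnisotropic ((PlaneData.mixedRow q (a 0) (a 2)).withTransportedTorus g g' hgg' hg'g hgΩ))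
    (chi : torusT ((PlaneData.mixedRow q (a 0) (a 2)).withTransportedTorus g g' hgg' hg'g hgΩ) → ℂ)
    (hmul : ∀ s t, chi (s * t) = chi s * chi t)
    (hrat : ∀ t ∈ rationalOf ((PlaneData.mixedRow q (a 0) (a 2)).withTransportedTorus g g' hgg' hg'g hgΩ)
      (torusT ((PlaneData.mixedRow q (a 0) (a 2)).withTransportedTorus g g' hgg' hg'g hgΩ)), chi t = 1)
    (hcont : Continuous chi) (hunit : ∀ t, ‖chi t‖ = 1)
    (hDE' : letI : CommGroup (torusT' ((PlaneData.mixedRow q (a 0) (a 2)).withTransportedTorus g g' hgg' hg'g hgΩ)) :=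
        { (inferInstance : Group (torusT' ((PlaneData.mixedRow q (a 0) (a 2)).withTransportedTorus g g' hgg' hg'g hgΩ)))
          with mul_comm := torusT'_seesaw_mul_comm q a g g' hgg' hg'g hgΩ lam hlam hiso (ha 1) (ha 3) }
      haveI : IsClosed ((rationalOf ((PlaneData.mixedRow q (a 0) (a 2)).withTransportedTorus g g' hgg' hg'g hgΩ)
          (torusT' ((PlaneData.mixedRow q (a 0) (a 2)).withTransportedTorus g g' hgg' hg'g hgΩ)) :
          Subgroup (torusT' ((PlaneData.mixedRow q (a 0) (a 2)).withTransportedTorus g g' hgg' hg'g hgΩ))) :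
          Set (torusT' ((PlaneData.mixedRow q (a 0) (a 2)).withTransportedTorus g g' hgg' hg'g hgΩ))) :=
        isClosed_rationalOf_torusT' _
      haveI : CompactSpace (torusT' ((PlaneData.mixedRow q (a 0) (a 2)).withTransportedTorus g g' hgg' hg'g hgΩ) ⧸
          rationalOf ((PlaneData.mixedRow q (a 0) (a 2)).withTransportedTorus g g' hgg' hg'g hgΩ)
            (torusT' ((PlaneData.mixedRow q (a 0) (a 2)).withTransportedTorus g g' hgg' hg'g hgΩ))) :=
        compactSpace_quotient_of_cocompact _ (cocompact_rationalOf_torusT'_of_anisotropic _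
          (isGenuineRow_seesawPlane q ht hn a (ha 0) (ha 2) g g' hgg' hg'g hgΩ lam hlam hiso) hA)
      DeitmarEchterhoff2014_Cor_3_6_2_restriction_surjective
        (torusT' ((PlaneData.mixedRow q (a 0) (a 2)).withTransportedTorus g g' hgg' hg'g hgΩ) ⧸
          rationalOf ((PlaneData.mixedRow q (a 0) (a 2)).withTransportedTorus g g' hgg' hg'g hgΩ)
            (torusT' ((PlaneData.mixedRow q (a 0) (a 2)).withTransportedTorus g g' hgg' hg'g hgΩ))))
    (eP eM eP' eM' : InfinitePlace k → ℤ)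
    (hchi : ∀ w, ChiMatchesAt ((PlaneData.mixedRow q (a 0) (a 2)).withTransportedTorus g g' hgg' hg'g hgΩ) q w (eP w)
      (eM w) chi)
    (hagree : ∀ t : GA ((PlaneData.mixedRow q (a 0) (a 2)).withTransportedTorus g g' hgg' hg'g hgΩ),
      t ∈ torusT ((PlaneData.mixedRow q (a 0) (a 2)).withTransportedTorus g g' hgg' hg'g hgΩ) →
      t ∈ torusT' ((PlaneData.mixedRow q (a 0) (a 2)).withTransportedTorus g g' hgg' hg'g hgΩ) →
      t ∈ infinitePart ((PlaneData.mixedRow q (a 0) (a 2)).withTransportedTorus g g' hgg' hg'g hgΩ) →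
      (∏ w : InfinitePlace k,
        (weightAt ((PlaneData.mixedRow q (a 0) (a 2)).withTransportedTorus g g' hgg' hg'g hgΩ) q w 0 t ^ (-(eP w)) *
          weightAt ((PlaneData.mixedRow q (a 0) (a 2)).withTransportedTorus g g' hgg' hg'g hgΩ) q w 1 t ^ (-(eM w)))) =
        torusWeight' q a g g' hgg' hg'g hgΩ eP' eM' t) :
    ∃ chi' : torusT' ((PlaneData.mixedRow q (a 0) (a 2)).withTransportedTorus g g' hgg' hg'g hgΩ) → ℂ,
      (∀ s t, chi' (s * t) = chi' s * chi' t) ∧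
      (∀ t ∈ rationalOf ((PlaneData.mixedRow q (a 0) (a 2)).withTransportedTorus g g' hgg' hg'g hgΩ)
        (torusT' ((PlaneData.mixedRow q (a 0) (a 2)).withTransportedTorus g g' hgg' hg'g hgΩ)), chi' t = 1) ∧
      Continuous chi' ∧ (∀ t, ‖chi' t‖ = 1) ∧
      (∀ w : InfinitePlace k, ChiMatchesAt' ((PlaneData.mixedRow q (a 0) (a 2)).withTransportedTorus g g' hgg' hg'g hgΩ)
        q w g g' (eP' w) (eM' w) chi') ∧
      ∀ (z : GA ((PlaneData.mixedRow q (a 0) (a 2)).withTransportedTorus g g' hgg' hg'g hgΩ))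
        (hz : z ∈ centre ((PlaneData.mixedRow q (a 0) (a 2)).withTransportedTorus g g' hgg' hg'g hgΩ)),
        chi ⟨z, centre_le_torusT _ hz⟩ = chi' ⟨z, centre_le_torusT' _ hz⟩ :=
  exists_wall_character'_pair_seesaw_of_aniso q a g g' hgg' hg'g hgΩ lam hlam hiso ht hn ha hreal hcm hA chi hmul hcont
    hunit hDE' eP' eM'
    (hcons_of_weights_agree q a g g' hgg' hg'g hgΩ (ha 0) (ha 2) hreal hcm chi hmul hrat hunit eP eM eP' eM' hchi hagree)

end Cons

end Summit.Ventures.HodgeRepro.Tier4.Line4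

end
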